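import Mathlib
import HarnessLib
import Literature.Analysis.FluidPDE.VectorCalculus
import Literature.Analysis.FluidPDE.Vorticity

/-! # Sketch — «capsym-comparison» price P5(ii): the twisted-cap kinematics, TYPED
(crux `PoloidalLiouville` = stmt-NavierStokesRegularity-1222, wall W1 = `stub_scalarLiouville`; ns-idea-13 g2, lens «transfer»).

Two frozen-time, NS-free, purely KINEMATIC statements about a smooth divergence-free `v` on `ℝ³` whose vorticity is
unthreaded about `x₀`, `curl v = ∇T × (x − x₀)`, whose toroidal potential `T` is a TWISTED CAP
`T(x) = U(r, ⟪ξ, e(r)⟫)` (`r = ‖x − x₀‖`, `ξ = (x − x₀)/r`, `‖e(r)‖ = 1`, `U(r,·)` strictly monotone), and which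
satisfies the LOOP-MOMENTUM CONSTRAINT `⟪x − x₀, ∇m × ∇T⟫ = 0` off `x₀` (`m := ⟪v, x − x₀⟫`; this is the radial
component of hypothesis (E1) of `StubScalarLiouville`, i.e. "`m` is constant on the vortex loops").

* `TwistedCapIsDipole` (idea-crit-8 V51 price P5(ii)): on a shell where the axis turns (`e′ ≠ 0`) the profile is
  AFFINE, `T = U₀(r) + λ(r)⟪ξ, e(r)⟫`.  Proof sketch (worksheet `TwistedCapKinematics.md` §B): `Δm = Δ_ξ T` (from
  `div v = 0`, `Δ(⟪x−x₀,v⟫) = ⟪x−x₀, Δv⟫ = −⟪x−x₀, curl curl v⟫ = Δ_ξT`); write `m = M(r, ⟪ξ,e(r)⟫)`; the `cos 2φ`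
  Fourier mode of `Δm` about the axis `e(r)` is `½ M_cc |e′|² (1 − c²)`, while `Δ_ξ T` is zonal ⇒ `M_cc = 0`; then the
  zonal mode forces `∂_c((1 − c²) U_c)` affine in `c`, and boundedness of `U_c` at `c = ±1` gives `U` affine.
* `TwistedCapNoTwist` (NEW, worksheet §C–§D): a GLOBAL twisted cap (all `r > 0`, `v ∈ C³(ℝ³)` — smooth AT `x₀`)
  does not twist at all: `e′ ≡ 0`.  Proof sketch: by the first statement the twisting shells are dipole shells; there
  the `ℓ = 1` moment `c(r)` of `m` on `S_r` obeys `c″ + (4/r) c′ = −(2/r) λ e` with `c ∥ e` (this is `Δm = Δ_ξT` again),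
  whence `e` moves on a great circle and `J := |c|² r⁴ ‖e′‖` is constant on every interval where `c ≠ 0 ≠ e′`; such an
  interval can have no end-point in `(0, ∞)` (`J > 0` would force `|c| → ∞` or `‖e′‖ → ∞`) and cannot reach `r → 0`
  (`c(r) → v(x₀)` with `c′` bounded forces `‖e′‖ = J |c|⁻² r⁻⁴`, non-integrable), so `c ≡ 0` near every twist point,
  and then the `e`-component `λ = −(r/2)(γ″ + 4γ′/r − γ‖e′‖²)` (`c = γ e`) vanishes: no vorticity where the axis turns,
  contradicting strict monotonicity of `U(r,·)`.

CONSEQUENCE recorded on the card (v3.2): g0's RUNG′ `CapSym.TwistedCapLiouville` is TRUE BUT NOT A RUNG — modulo these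
two kinematic lemmas it reduces to the fixed-axis (KNSS Thm 5.2) regime; it is withdrawn as a BC5-type witness.  The
first genuinely non-axisymmetric rung of the line remains `CapSym.UnimodalScalarLiouville`.
No NS statement is touched; `PoloidalLiouville` (1222) and `stub_scalarLiouville` stay OPEN; NS regularity is NOT proved.
Props only, no proofs, no `sorry`. -/

noncomputable section

-- the summit and its single sub-problem share the name (CONVENTIONS §1)
set_option linter.dupNamespace false

namespace Summit.NavierStokesRegularity.NavierStokesRegularity.Cruxes.PoloidalLiouville.CapSym

open scoped InnerProductSpace RealInnerProductSpace
open Set Function Literature.Analysis.FluidPDE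

/-- (P5(ii), kinematic, frozen time, M) **A twisted cap with a turning axis is a dipole.**
`v ∈ C³(ℝ³)` divergence-free, `curl v = ∇T × (x − x₀)`, loop-momentum constraint `⟪x − x₀, ∇m × ∇T⟫ = 0`
(`m = ⟪v, x − x₀⟫`), and on the shell `r₁ < ‖x − x₀‖ < r₂`: `T = U(r, ⟪x − x₀, e(r)⟫/r)` with `‖e‖ = 1`,
`e′ ≠ 0` at EVERY radius of the shell (the axis turns throughout; interval bookkeeping is `TwistedCapNoTwist`'s),
`U(r,·)` strictly monotone on `[−1,1]`.  THEN `U(r,·)` is affine: `T = U₀(r) + λ(r)·⟪x − x₀, e(r)⟫/r`.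
(v2, critic remark r1: the curl clause is stated for `x ≠ x₀` only — `gradient T x₀` is a junk value since `T` is
only `C²` off `x₀`; `curl v x₀ = 0` then FOLLOWS for continuous `curl v` from `∫_{S_ρ(x₀)} n × ∇T dσ = 0`, it is not assumed.) -/
def TwistedCapIsDipole : Prop :=
  ∀ (v : EuclideanSpace ℝ (Fin 3) → EuclideanSpace ℝ (Fin 3)) (x₀ : EuclideanSpace ℝ (Fin 3))
    (T : EuclideanSpace ℝ (Fin 3) → ℝ) (U : ℝ → ℝ → ℝ) (e : ℝ → EuclideanSpace ℝ (Fin 3)) (r₁ r₂ : ℝ),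
    0 < r₁ → r₁ < r₂ →
    ContDiff ℝ 3 v → VectorCalculus.IsDivFree v →
    ContDiffOn ℝ 2 T ({x₀}ᶜ) →
    (∀ x, x ≠ x₀ → curl v x = cross (gradient T x) (x - x₀)) →
    (∀ x, x ≠ x₀ →
      inner ℝ (x - x₀) (cross (gradient (fun z => inner ℝ (v z) (z - x₀)) x) (gradient T x)) = 0) →
    ContDiffOn ℝ 2 e (Ioo r₁ r₂) → (∀ r ∈ Ioo r₁ r₂, ‖e r‖ = 1) → (∀ r ∈ Ioo r₁ r₂, deriv e r ≠ 0) →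
    ContDiff ℝ 2 (uncurry U) → (∀ r ∈ Ioo r₁ r₂, StrictMonoOn (U r) (Icc (-1) 1)) →
    (∀ x, ‖x - x₀‖ ∈ Ioo r₁ r₂ →
      T x = U ‖x - x₀‖ (inner ℝ (x - x₀) (e ‖x - x₀‖) / ‖x - x₀‖)) →
    ∃ U₀ lam : ℝ → ℝ, ∀ x, ‖x - x₀‖ ∈ Ioo r₁ r₂ →
      T x = U₀ ‖x - x₀‖ + lam ‖x - x₀‖ * (inner ℝ (x - x₀) (e ‖x - x₀‖) / ‖x - x₀‖)

/-- (NEW, kinematic, frozen time, M) **Global twisted caps do not twist.**  Same data as `TwistedCapIsDipole`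
but on ALL of `ℝ³ ∖ {x₀}` (`e ∈ C²(0,∞)`, `U(r,·)` strictly monotone for every `r > 0`) and with `v ∈ C³` on the
whole space (smooth AT the centre): then the axis is constant, `e′(r) = 0` for every `r > 0` — i.e. `T` is zonal
about ONE fixed axis, the KNSS Thm 5.2 regime.  (Strict monotonicity = non-zero vorticity on every sphere; without
it the conclusion holds on each radial interval of spheres carrying vorticity.) -/
def TwistedCapNoTwist : Prop :=
  ∀ (v : EuclideanSpace ℝ (Fin 3) → EuclideanSpace ℝ (Fin 3)) (x₀ : EuclideanSpace ℝ (Fin 3))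
    (T : EuclideanSpace ℝ (Fin 3) → ℝ) (U : ℝ → ℝ → ℝ) (e : ℝ → EuclideanSpace ℝ (Fin 3)),
    ContDiff ℝ 3 v → VectorCalculus.IsDivFree v →
    ContDiffOn ℝ 2 T ({x₀}ᶜ) →
    (∀ x, x ≠ x₀ → curl v x = cross (gradient T x) (x - x₀)) →
    (∀ x, x ≠ x₀ →
      inner ℝ (x - x₀) (cross (gradient (fun z => inner ℝ (v z) (z - x₀)) x) (gradient T x)) = 0) →
    ContDiffOn ℝ 2 e (Ioi 0) → (∀ r > 0, ‖e r‖ = 1) →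
    ContDiff ℝ 2 (uncurry U) → (∀ r > 0, StrictMonoOn (U r) (Icc (-1) 1)) →
    (∀ x, x ≠ x₀ → T x = U ‖x - x₀‖ (inner ℝ (x - x₀) (e ‖x - x₀‖) / ‖x - x₀‖)) →
    ∀ r > 0, deriv e r = 0

end Summit.NavierStokesRegularity.NavierStokesRegularity.Cruxes.PoloidalLiouville.CapSym

end
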